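import Literature.ModelTheory.ExponentialFields.Wilkie1989Khovanskii
import Mathlib.LinearAlgebra.Matrix.Block
import HarnessLib

/-!
# Wilkie 1989, §5: Khovanskii's bound for square systems with arbitrary parameters and any number of variables

Trunk `TranscendEllArithS`, family `periods` (periods.S28): towards the leaf
`Literature.ModelTheory.ExponentialFields.Wilkie1989_expAlgebraicPoints_mem` (`Wilkie1989.lean`;
§§5–6 of A. J. Wilkie, *On the theory of the real exponential field*, Illinois J. Math. 33
(1989), 384–408).

`Wilkie1989Khovanskii.lean` vendors the Proposition of §5 (Khovanskii's finiteness theorem, the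
named fact `Literature.ModelTheory.ExponentialFields.Wilkie1989_khovanskiiProposition`) and proves
from it, by transfer, the bound used on p. 406: for a square system of terms
`f₁(ȳ, x̄), …, fₙ(ȳ, x̄)` with `n ≥ 2` variables and parameters `ȳ` indexed by `Fin m`, the
non-singular zero set `Vⁿˢ(f₁(ā, ·), …, fₙ(ā, ·)) ⊆ Kⁿ` has at most `N` points in every model `K` of
`T_exp`, uniformly in `ā` (`Wilkie1989_khovanskiiProposition.exists_encard_nonsingularZeroSet_le`).
In §6 the bound is applied to systems whose parameters are the elements of the submodel `k`
(terms of `k[x̄]ᵉ`, parameter type `↥k`) and to slices of curves, and the height-`0` case of the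
induction (`Wilkie1989HeightZero.lean`) needs the finiteness of `Vⁿˢ` for `n = 1` as well.  This
file removes both restrictions (**proved**, given the Proposition):

* `RealExpModel.exists_finParams`: a finite family of terms with parameters from any type `κ` uses
  only finitely many of them — it is the renaming of a family with parameters in some `Fin m`
  (`Term.restrictVarLeft`); the non-singular zero sets agree
  (`RealExpModel.nonsingularZeroSet_finParams`, using that `∂/∂xᵢ` respects renaming of
  parameters and equality of term functions, `realize_termPDeriv_relabel_params`,
  `realize_termPDeriv_congr`).
* `RealExpModel.padSys`: the system `(f₁, …, fₙ, xₙ₊₁, xₙ₊₂)` in `n + 2` variables, whose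
  non-singular zeros contain `(ᾱ, 0, 0)` for every non-singular zero `ᾱ` of `f̄`
  (`RealExpModel.appendZero_mem_nonsingularZeroSet_padSys`, a block-determinant computation,
  `RealExpModel.det_eq_of_pad`), so that `|Vⁿˢ(f̄)| ≤ |Vⁿˢ(f̄, xₙ₊₁, xₙ₊₂)|`.
* `Wilkie1989_khovanskiiProposition.exists_encard_nonsingularZeroSet_le'`: for every square
  system of terms with parameters from any type `κ` and any number `n` of variables there is `N`
  with `|Vⁿˢ| ≤ N` in every model of `T_exp`, uniformly in the parameters; in particular `Vⁿˢ` is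
  finite (`Wilkie1989_khovanskiiProposition.finite_nonsingularZeroSet`).

## References

* A. J. Wilkie, *On the theory of the real exponential field*, Illinois J. Math. 33 (1989),
  384–408: §5, Proposition (p. 402) and p. 403; §6, pp. 403, 406.
-/

noncomputable section

open FirstOrder FirstOrder.Language FirstOrder.Language.Structure

namespace Literature.ModelTheory.ExponentialFields

namespace RealExpModel

/-! ### Finitely many parameters -/

section FinParams

variable {κ : Type} {n p : ℕ}

/-- **A finite family of terms uses finitely many parameters**: it is obtained by renaming the
parameters of a family with parameters in some `Fin m`, with the same realizations. [folklore] -/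
theorem exists_finParams (t : Fin p → Language.orderedExpRing.Term (κ ⊕ Fin n)) :
    ∃ (m : ℕ) (g : Fin m → κ) (t' : Fin p → Language.orderedExpRing.Term (Fin m ⊕ Fin n)),
      ∀ (M : Type) [Language.orderedExpRing.Structure M] (a : κ → M) (x : Fin n → M) (i : Fin p),
        (t' i).realize (Sum.elim (a ∘ g) x) = (t i).realize (Sum.elim a x) := by
  classical
  set s : Finset κ := Finset.univ.biUnion fun i => (t i).varFinsetLeft with hs
  have hsub : ∀ i, ((t i).varFinsetLeft : Set κ) ⊆ (s : Set κ) := by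
    intro i x hx
    simp only [hs, Finset.coe_biUnion, Finset.coe_univ, Set.mem_univ, Set.iUnion_true,
      Set.mem_iUnion, Finset.mem_coe]
    exact ⟨i, hx⟩
  obtain ⟨e⟩ : Nonempty (↥(s : Set κ) ≃ Fin s.card) :=
    ⟨Fintype.equivFinOfCardEq (by simp)⟩
  refine ⟨s.card, fun j => ((e.symm j : ↥(s : Set κ)) : κ),
    fun i => ((t i).restrictVarLeft (Set.inclusion (hsub i))).relabel (Sum.map e _root_.id),
    fun M _ a x i => ?_⟩
  rw [Term.realize_relabel]
  have hcomp : (Sum.elim (a ∘ fun j => ((e.symm j : ↥(s : Set κ)) : κ)) x ∘ Sum.map (⇑e) _root_.id :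
      ↥(s : Set κ) ⊕ Fin n → M) = Sum.elim (a ∘ (↑)) x := by
    funext z
    rcases z with z | z <;> simp
  rw [hcomp]
  exact Term.realize_restrictVarLeft' (hsub i)

/-- **The non-singular zero set does not change under such a renaming of parameters** (in a model
of `T_exp`: the zero sets agree by the realization identity, and the gradient rows agree because
`∂/∂xᵢ` respects renaming of parameters and equality of term functions). [folklore] -/
theorem nonsingularZeroSet_finParams (K : Language.Theory.ModelType.{0, 0, 0} realExpTheory)
    {m : ℕ} {g : Fin m → κ} {t : Fin p → Language.orderedExpRing.Term (κ ⊕ Fin n)}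
    {t' : Fin p → Language.orderedExpRing.Term (Fin m ⊕ Fin n)}
    (h : ∀ (a : κ → K) (x : Fin n → K) (i : Fin p),
      (t' i).realize (Sum.elim (a ∘ g) x) = (t i).realize (Sum.elim a x))
    (a : κ → K) : nonsingularZeroSet t' (a ∘ g) = nonsingularZeroSet t a := by
  have hgrad : ∀ (x : Fin n → K) (i : Fin p), grad (t' i) (a ∘ g) x = grad (t i) a x := by
    intro x i
    funext j
    rw [grad_apply, grad_apply]
    have e1 : (Sum.elim (a ∘ g) x : Fin m ⊕ Fin n → K) = Sum.elim a x ∘ Sum.map g _root_.id := by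
      funext z; rcases z with z | z <;> rfl
    rw [e1, ← realize_termPDeriv_relabel_params]
    refine realize_termPDeriv_congr K a j _ _ (fun y => ?_) x
    rw [Term.realize_relabel]
    have e2 : (Sum.elim a y ∘ Sum.map g _root_.id : Fin m ⊕ Fin n → K) = Sum.elim (a ∘ g) y := by
      funext z; rcases z with z | z <;> rfl
    rw [e2]
    exact h a y i
  ext x
  simp only [mem_nonsingularZeroSet, mem_zeroSet, h, hgrad]

end FinParams

/-! ### Padding a square system with two dummy variables -/

section Pad

variable {κ : Type} {n : ℕ}

/-- The square system `(f₁, …, fₙ, xₙ₊₁, xₙ₊₂)` in the variables `x₁, …, xₙ₊₂`. [folklore] -/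
def padSys (t : Fin n → Language.orderedExpRing.Term (κ ⊕ Fin n)) :
    Fin (n + 2) → Language.orderedExpRing.Term (κ ⊕ Fin (n + 2)) :=
  Fin.append (fun i => (t i).relabel (Sum.map _root_.id (Fin.castAdd 2)))
    (fun j => var (Sum.inr (Fin.natAdd n j)))

/-- The first `n` equations of the padded system. [folklore] -/
theorem padSys_castAdd (t : Fin n → Language.orderedExpRing.Term (κ ⊕ Fin n)) (i : Fin n) :
    padSys t (Fin.castAdd 2 i) = (t i).relabel (Sum.map _root_.id (Fin.castAdd 2)) := by
  simp [padSys]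

/-- The last two equations of the padded system. [folklore] -/
theorem padSys_natAdd (t : Fin n → Language.orderedExpRing.Term (κ ⊕ Fin n)) (j : Fin 2) :
    padSys t (Fin.natAdd n j) = var (Sum.inr (Fin.natAdd n j)) := by
  simp [padSys]

/-- **A block determinant**: a square matrix of size `n + 2` whose upper right `n × 2` block
vanishes and whose lower right `2 × 2` block is the identity has the determinant of its upper left
`n × n` block. [folklore] -/
theorem det_eq_of_pad {R : Type*} [CommRing R] (P : Matrix (Fin (n + 2)) (Fin (n + 2)) R)
    (J : Matrix (Fin n) (Fin n) R) (h11 : ∀ i l, P (Fin.castAdd 2 i) (Fin.castAdd 2 l) = J i l)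
    (h12 : ∀ i l, P (Fin.castAdd 2 i) (Fin.natAdd n l) = 0)
    (h22 : ∀ j l, P (Fin.natAdd n j) (Fin.natAdd n l) = (1 : Matrix (Fin 2) (Fin 2) R) j l) :
    P.det = J.det := by
  set C : Matrix (Fin 2) (Fin n) R := Matrix.of fun j l => P (Fin.natAdd n j) (Fin.castAdd 2 l)
    with hC
  have hP : P = Matrix.reindex finSumFinEquiv finSumFinEquiv (Matrix.fromBlocks J 0 C 1) := by
    ext i j
    refine Fin.addCases (fun i => ?_) (fun i => ?_) i <;>
      refine Fin.addCases (fun j => ?_) (fun j => ?_) j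
    · simp [h11]
    · simp [h12]
    · simp [hC]
    · simp [h22]
  rw [hP, Matrix.det_reindex_self, Matrix.det_fromBlocks_zero₁₂, Matrix.det_one, mul_one]

variable {K : Language.Theory.ModelType.{0, 0, 0} realExpTheory}

/-- **`(ᾱ, 0, 0)` is a non-singular zero of the padded system whenever `ᾱ` is one of the
original system.** [folklore] -/
theorem appendZero_mem_nonsingularZeroSet_padSys {t : Fin n → Language.orderedExpRing.Term (κ ⊕ Fin n)}
    {a : κ → K} {y : Fin n → K} (hy : y ∈ nonsingularZeroSet t a) :
    Fin.append y (0 : Fin 2 → K) ∈ nonsingularZeroSet (padSys t) a := by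
  set z : Fin (n + 2) → K := Fin.append y 0 with hz
  have hzc : (Sum.elim a z ∘ Sum.map _root_.id (Fin.castAdd 2) : κ ⊕ Fin n → K) = Sum.elim a y := by
    funext w; rcases w with w | w <;> simp [hz]
  refine ⟨fun r => ?_, ?_⟩
  · refine Fin.addCases (fun i => ?_) (fun j => ?_) r
    · rw [padSys_castAdd, Term.realize_relabel, hzc]
      exact hy.1 i
    · rw [padSys_natAdd]
      simp [hz]
  · rw [linearIndependent_rows_iff_det_ne_zero]
    have hJ : (Matrix.of fun r => grad (t r) a y).det ≠ 0 :=
      (linearIndependent_rows_iff_det_ne_zero (Matrix.of fun r => grad (t r) a y)).1 hy.2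
    change (Matrix.of fun r => grad (padSys t r) a z).det ≠ 0
    rw [det_eq_of_pad (Matrix.of fun r => grad (padSys t r) a z) (Matrix.of fun r => grad (t r) a y)]
    · exact hJ
    · intro i l
      rw [Matrix.of_apply, Matrix.of_apply, grad_apply, grad_apply, padSys_castAdd,
        realize_termPDeriv_relabel_of_injective (Fin.castAdd_injective n 2), hzc]
    · intro i l
      rw [Matrix.of_apply, grad_apply, padSys_castAdd]
      refine realize_termPDeriv_relabel_of_not_mem_range _ ?_ _ _
      rintro ⟨l', hl'⟩
      have := congrArg Fin.val hl'
      simp at this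
      omega
    · intro j l
      rw [Matrix.of_apply, grad_apply, padSys_natAdd]
      by_cases hjl : j = l
      · subst hjl
        simp [termPDeriv]
      · have : Fin.natAdd n j ≠ Fin.natAdd n l := fun h' => hjl (by
          have := congrArg Fin.val h'
          simp at this
          exact Fin.ext this)
        simp [termPDeriv, this, hjl]

/-- Hence the padded system has at least as many non-singular zeros. [folklore] -/
theorem encard_nonsingularZeroSet_le_padSys (t : Fin n → Language.orderedExpRing.Term (κ ⊕ Fin n))
    (a : κ → K) : (nonsingularZeroSet t a).encard ≤ (nonsingularZeroSet (padSys t) a).encard := by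
  have hinj : Function.Injective fun y : Fin n → K => Fin.append y (0 : Fin 2 → K) := by
    intro y y' h
    funext i
    have := congrFun h (Fin.castAdd 2 i)
    simpa using this
  rw [← hinj.encard_image]
  refine Set.encard_le_encard ?_
  rintro _ ⟨y, hy, rfl⟩
  exact appendZero_mem_nonsingularZeroSet_padSys hy

end Pad

/-! ### The bound for arbitrary parameters and any number of variables -/

/-- **Khovanskii's bound, transferred, for square systems with parameters from any type and any
number of variables** (Wilkie 1989, p. 403: "It thus follows that Lemmas 4 and 6 can be expressed as
first-order sentences of `L` … uniformly in the parameters occurring in the `g`'s"; p. 406): given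
the Proposition of §5, for terms `f₁, …, fₙ` with parameters from `κ` there is `N` such that in
every model `K` of `T_exp` and for all parameter values, `|Vⁿˢ(f₁, …, fₙ)| ≤ N`. [cite: Wilkie1989, §5, p. 403] -/
theorem _root_.Literature.ModelTheory.ExponentialFields.Wilkie1989_khovanskiiProposition.exists_encard_nonsingularZeroSet_le'
    (H : Wilkie1989_khovanskiiProposition) {κ : Type} {n : ℕ}
    (t : Fin n → Language.orderedExpRing.Term (κ ⊕ Fin n)) :
    ∃ N : ℕ, ∀ (K : Language.Theory.ModelType.{0, 0, 0} realExpTheory) (a : κ → K),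
      (nonsingularZeroSet t a).encard ≤ N := by
  obtain ⟨m, g, t', ht'⟩ := exists_finParams t
  obtain ⟨N, hN⟩ := H.exists_encard_nonsingularZeroSet_le m (n + 2) (by omega) (padSys t')
  refine ⟨N, fun K a => ?_⟩
  rw [← nonsingularZeroSet_finParams K (fun a x i => ht' K a x i) a]
  exact (encard_nonsingularZeroSet_le_padSys t' (a ∘ g)).trans (hN K (a ∘ g))

/-- In particular the non-singular zero set of a square system of terms (any parameters, any number
of variables) is finite in every model of `T_exp`. [cite: Wilkie1989, §5, p. 403] -/
theorem _root_.Literature.ModelTheory.ExponentialFields.Wilkie1989_khovanskiiProposition.finite_nonsingularZeroSet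
    (H : Wilkie1989_khovanskiiProposition) {κ : Type} {n : ℕ}
    (t : Fin n → Language.orderedExpRing.Term (κ ⊕ Fin n))
    (K : Language.Theory.ModelType.{0, 0, 0} realExpTheory) (a : κ → K) :
    (nonsingularZeroSet t a).Finite := by
  obtain ⟨N, hN⟩ := H.exists_encard_nonsingularZeroSet_le' t
  exact Set.finite_of_encard_le_coe (hN K a)

end RealExpModel

end Literature.ModelTheory.ExponentialFields
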